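import Summits.ResolutionOfSingularities.ResolutionOfSingularities.Theorems.PurelyInseparableDim4SpineRuleS
import Summits.ResolutionOfSingularities.ResolutionOfSingularities.Theorems.PurelyInseparableDim4SpineD1
import Summits.ResolutionOfSingularities.ResolutionOfSingularities.Theorems.PurelyInseparableDim4SpineDictionary
import HarnessLib

/-!
# [OURS · res-dim4-pi PR-9c, annex 2] MODE S as a STATE rule: `ruleS` is a permissible coordinate-centre rule with
  no infinite spine branch, over every field

Cell `res-dim4-pi` (D-0157 DOOR 2), seat `res-dim4-p-11`.  Sequel of `PurelyInseparableDim4SpineRuleS` (the support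
rule `spineRuleS q` = Spivakovsky's strategy wins the PURE game).  Here the rule is lifted to presented states exactly
as the engines run MODE S (read the centre off the support of the cleaned `F`; the point at `F = 0`), and the two
tree dictionaries are applied: LEMMA D1 (`SpineD1.isPurePlay_succ_of_isSpinePlay`, p-10) turns the pure win into a
win of the spine game with deletions, and the support dictionary (`SpineDictionary.isSpinePositionalWin_iff`, p-7)
turns that into spine termination of the state rule.

* `ruleS q : CentreRule K` — MODE S of record at state level [cite: Spivakovsky1983, §II];
* `isPermissibleRule_ruleS` — it is a permissible rule (Hironaka's condition (1));
* `isSpinePositionalWin_spineRuleS : 0 < q → IsSpinePositionalWin q (spineRuleS q)`;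
* **`spineTerminatesUnder_ruleS : 0 < q → SpineTerminatesUnder q (ruleS q)`** — over EVERY field, MODE S has no
  infinite branch of spine edges (chart origins); `spineTerminatesSomeRule_of_ruleS` re-derives F4-S with the named
  witness.  (F4-C `TerminatesInScope` asks for such a rule on ALL in-scope edges; `ruleS` is the cell's candidate of
  record there — NOT proved here.)

[OURS · counted 0 · AI work weaker than expert review] A statement about OUR frame's coordinate game at chart origins;
NOTHING here proves resolution of singularities in dimension ≥ 4 / characteristic `p`. bears_on:
LADDER-RESOLUTION:D157-DOOR2 (res-dim4-pi · PR-9c annex · MODE S). Supports stmt-ResolutionOfSingularities-16155 (helper).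
-/

set_option linter.dupNamespace false -- mandated namespace of this single-conjunct summit

namespace Summit.ResolutionOfSingularities.ResolutionOfSingularities.Theorems.PIDim4

open Finset

/-- **MODE S at state level**: read Spivakovsky's rule off the support of `F`; the point `univ` at `F = 0` (no
successor there anyway). [cite: Spivakovsky1983, §II (the winning strategy)] -/
noncomputable def ruleS {K : Type} [Field K] [DecidableEq K] (q : ℕ) : CentreRule K :=
  fun s => if s.F = 0 then (Finset.univ : Finset (Fin 4)) else spineRuleS q s.F.support

namespace SpineRuleS

variable {K : Type} [Field K] [DecidableEq K] {q : ℕ}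

/-- `ruleS` reads `spineRuleS` off the support of every non-zero `F`. [folklore] -/
theorem ruleS_eq_of_ne_zero (s : State K) (hs : s.F ≠ 0) : ruleS q s = spineRuleS q s.F.support := by
  simp [ruleS, hs]

/-- At `F = 0` the rule names the point. [folklore] -/
theorem ruleS_eq_of_eq_zero (s : State K) (hs : s.F = 0) : ruleS q s = Finset.univ := by
  simp [ruleS, hs]

/-- **MODE S is a permissible rule** (condition (1) whenever some permissible centre exists).
[cite: Spivakovsky1983, §III Corollary] -/
theorem isPermissibleRule_ruleS (hq : 0 < q) : IsPermissibleRule q (ruleS (K := K) q) :=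
  SpineDictionary.isPermissibleRule_of_agrees q (spineRuleS q) (fun _ hA => spinePermissible_spineRuleS hq hA)
    (fun s hs => ruleS_eq_of_ne_zero s hs) (fun s hs => by rw [ruleS_eq_of_eq_zero s hs]; exact Finset.univ_nonempty)

/-- **MODE S wins the spine game with deletions** (LEMMA D1 applied to the pure win). [folklore] -/
theorem isSpinePositionalWin_spineRuleS (hq : 0 < q) : IsSpinePositionalWin q (spineRuleS q) := by
  obtain ⟨hperm, hno⟩ := isPurePositionalWin_spineRuleS hq
  refine ⟨hperm, ?_⟩
  rintro ⟨A, hA⟩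
  exact hno ⟨fun k => A (k + 1), SpineD1.isPurePlay_succ_of_isSpinePlay hperm hA⟩

/-- **MODE S has no infinite spine branch**, over every field: the named witness of F4-S.
[cite: Spivakovsky1983, Theorem p. 421] -/
theorem spineTerminatesUnder_ruleS (hq : 0 < q) : SpineTerminatesUnder q (ruleS (K := K) q) :=
  ((SpineDictionary.isSpinePositionalWin_iff q (spineRuleS q) (R := ruleS (K := K) q)
    (fun s hs => ruleS_eq_of_ne_zero s hs)).mp (isSpinePositionalWin_spineRuleS hq)).2

/-- F4-S with the witness named: for `0 < q`, MODE S is a permissible rule with no infinite spine branch over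
every field of every characteristic. [cite: Spivakovsky1983, Theorem p. 421] -/
theorem spineTerminatesSomeRule_of_ruleS (p : ℕ) (hq : 0 < q) : SpineTerminatesSomeRule p q :=
  fun K _ _ _ => ⟨ruleS (K := K) q, isPermissibleRule_ruleS hq, spineTerminatesUnder_ruleS hq⟩

end SpineRuleS

end Summit.ResolutionOfSingularities.ResolutionOfSingularities.Theorems.PIDim4
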